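import Summits.NavierStokesRegularity.TurbBounds.ShearSpecLadder
import Summits.NavierStokesRegularity.TurbBounds.LegendreCoeffs
import HarnessLib

/-!
# Bridge, norm part: `A∫W″² + 8∫W′² + C∫W² = cᵀQ1c + (tails)` for a real polynomial component (rbsdp SPEC 2.4–2.5, FW16 (B3))

Cell `turb-bounds` (pub-turb), shear lane, pub-turb-shear gen 6 (2026-08-22); v2 lane. First ANALYTIC link of the fw16 chain, on the tree's
`LegendreCoeffs` (finite Parseval, integration ladder at the wall `x = −1`): for `W : ℝ[X]` with `W(−1) = W′(−1) = 0` and `c, a, b` the Legendre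
coefficients of `W″, W′, W`, the three weighted norms of SPEC 2.2's `G_m` split EXACTLY into the tracked quadratic form `cᵀ Q1 c` (the table
`q1Tab N P A C` of `ShearSpecPieces`, via `qform_q1Tab` + the ladder dictionary) plus the three tails `A·‖w̃₂‖² + 8·‖w̃₁‖² + C·‖w̃₀‖²` as finite windows
(the polynomial has finitely many coefficients) — theorem `norms_split`. The cross term (triple products) and the tail estimate are the next files.
HONEST FRAMING: rigorous bounds for the stated PDE and boundary conditions; no claim about physical turbulence beyond the bound.
-/

set_option linter.style.longLine false

noncomputable section

namespace Summit.NavierStokesRegularity.TurbBounds.ShearSpecPieces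

open Finset Polynomial intervalIntegral
open Summit.NavierStokesRegularity.TurbBounds.LadderTail (w IsLadder)
open Summit.NavierStokesRegularity.TurbBounds.LegendreCoeffs

/-- `norm2` is `LadderTail.w` (cast). -/
theorem norm2_cast (j : ℕ) : ((norm2 j : ℚ) : ℝ) = w j := by
  unfold norm2; rw [LegendreCoeffs.w_eq]; push_cast; ring

/-- Finite Parseval for a derivative-tower member, with a window split at `t ≤ L`. -/
theorem parseval_split (p : ℝ[X]) {L t : ℕ} (hp : p.natDegree < L) (ht : t ≤ L) :
    ∫ x in (-1 : ℝ)..1, p.eval x ^ 2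
      = ∑ k ∈ range t, w k * legCoeff p k ^ 2 + ∑ k ∈ range (L - t), w (t + k) * legCoeff p (t + k) ^ 2 := by
  rw [integral_sq_eq_sum_of_lt p hp, show L = t + (L - t) by omega, Finset.sum_range_add]
  congr 1
  rw [show t + (L - t) - t = L - t by omega]

/-- **Norm part of the bridge.** For `W : ℝ[X]` with `W(−1) = 0`, `W′(−1) = 0`, any `L ≥ N+P+4` with `deg W < L`, and `c, a, b` the Legendre coefficients of
`W″, W′, W`: `A∫W″² + 8∫W′² + C∫W² = cᵀ·Q1·c + A·Σ_{k<L−L2} w_{L2+k}c_{L2+k}² + 8·Σ_{k<L−(N+2)} w_{N+2+k}a_{N+2+k}² + C·Σ_{k<L−(N+1)} w_{N+1+k}b_{N+1+k}²` (`L2 = N+P+4`). -/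
theorem norms_split (N P : ℕ) (A C : ℚ) (W : ℝ[X]) (hW : W.eval (-1) = 0) (hW' : (derivative W).eval (-1) = 0)
    (L : ℕ) (hL : N + P + 4 ≤ L) (hdeg : W.natDegree < L) :
    (A : ℝ) * (∫ x in (-1 : ℝ)..1, (derivative (derivative W)).eval x ^ 2)
      + 8 * (∫ x in (-1 : ℝ)..1, (derivative W).eval x ^ 2)
      + (C : ℝ) * (∫ x in (-1 : ℝ)..1, W.eval x ^ 2)
    = qform (q1Tab N P A C) (N + P + 4) (legCoeff (derivative (derivative W)))
      + ((A : ℝ) * ∑ k ∈ range (L - (N + P + 4)), w (N + P + 4 + k) * legCoeff (derivative (derivative W)) (N + P + 4 + k) ^ 2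
        + 8 * ∑ k ∈ range (L - (N + 2)), w (N + 2 + k) * legCoeff (derivative W) (N + 2 + k) ^ 2
        + (C : ℝ) * ∑ k ∈ range (L - (N + 1)), w (N + 1 + k) * legCoeff W (N + 1 + k) ^ 2) := by
  -- degrees
  have hd1 : (derivative W).natDegree < L := lt_of_le_of_lt ((natDegree_derivative_le W).trans (Nat.sub_le _ _)) hdeg
  have hd2 : (derivative (derivative W)).natDegree < L :=
    lt_of_le_of_lt ((natDegree_derivative_le _).trans (Nat.sub_le _ _)) hd1
  -- Parseval with splits
  rw [parseval_split _ hd2 hL, parseval_split _ hd1 (show N + 2 ≤ L by omega), parseval_split _ hdeg (show N + 1 ≤ L by omega)]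
  -- the tracked form
  set c := legCoeff (derivative (derivative W)) with hc
  set a := legCoeff (derivative W) with ha
  set b := legCoeff W with hb
  have hA : IsLadder c a := isLadder_legCoeff (derivative W) hW'
  have h0a : a 0 = c 0 - c 1 / 3 := legCoeff_zero_of_wall (derivative W) hW'
  have hB : IsLadder a b := isLadder_legCoeff W hW
  have h0b : b 0 = a 0 - a 1 / 3 := legCoeff_zero_of_wall W hW
  rw [qform_q1Tab]
  have e1 : ∑ n ∈ range (N + 2), (norm2 n : ℝ) * lin (d1Rows N P) (N + P + 4) n c ^ 2 = ∑ n ∈ range (N + 2), w n * a n ^ 2 :=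
    Finset.sum_congr rfl fun n hn => by
      rw [norm2_cast, lin_d1Rows_eq_ladder hA h0a n (by simp at hn; omega)]
  have e2 : ∑ n ∈ range (N + 1), (norm2 n : ℝ) * lin (d0cRows N P) (N + P + 4) n c ^ 2 = ∑ n ∈ range (N + 1), w n * b n ^ 2 :=
    Finset.sum_congr rfl fun n hn => by
      rw [norm2_cast, lin_d0cRows_eq_ladder hA h0a hB h0b n (by simp at hn; omega)]
  have e0 : ∑ j ∈ range (N + P + 4), (norm2 j : ℝ) * c j ^ 2 = ∑ j ∈ range (N + P + 4), w j * c j ^ 2 :=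
    Finset.sum_congr rfl fun j _ => by rw [norm2_cast]
  rw [e0, e1, e2]
  ring

end Summit.NavierStokesRegularity.TurbBounds.ShearSpecPieces

end
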